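/-
Copyright (c) 2026 the pub-hodgecm-mathlib formalisation cell (harness21).  Prover seat hodgecm-mathlib-F0P3-p01 (g16) (S3-T0 co-reader); architect A-p16 (g30)
A-127 (1) (organs (b1)(b2) for the rider `stub_twoDeepRep_typeOne`, holder F0P3b-p01 (g12)), 2026-09-01.
-/
import Literature.NumberTheory.Rogawski1990.UnitFundamentalLemmaInertSplitClauseOfValues   -- ★ HEAD 1 + `mk_mem_conjClassesIn_of_isLocalNormPair`, `mk_ne_mk_of_finKappaAt_ne`
import HarnessLib

/-!
# Two frame-free organs for the rider «2-deep representatives, type (1)» (road «S3-tree», LIFT (H2D), END fold v3.1 `stub_twoDeepRep_typeOne`)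

Topic `NumberTheory/Rogawski1990`.  KERNEL lane: THEOREMS ONLY (no `def`, no instance, no notation, no named fact, no `sorry`); `--supports stmt-HodgeConjecture-24833`.
HONEST LABEL: HC_CM is proved only modulo the 2 remaining named inputs (hLiu418 24832, h413 24833) until rung 0 closes; this file pays no letter by itself.

THE MATHEMATICS.  The rider (A-118 (2) ∕ A-121 (2) ∕ A-127 (1)) says: near `1 ∈ H_v`, at a type-(1) non-Levi `G`-regular `γ_H`, every conjugacy class of `G′_v` in the support of
`Δ‴_v(γ_H, ·)` that meets `K` has a representative in `K` congruent to `1 (mod ϖ_v²)` at `w`.  Its proof (holder F0P3b-p01 (g12), over his ★ frames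
`exists_four_matched_flicker_representatives`) needs exactly two frame-free facts, typed here:
* §1 **`mk_eq_or_of_finExplicitDelta_out_ne_zero`** (= the ∃-form of the SUPPORT STEP of ★ HEAD 1 `finsum_delta_mul_classOrbitalIntegral_eq_of_four_classes_of_values`):
  with Flicker's four matched representatives `t₁, …, t₄` (matched with `ι_v(γ_H)`, type-(1) eigenframe on `t₁`, `t₁ ≁ t₂`, `t₃ ≁ t₄`, `κ = (+,+,−,−)`), a class `c` with
  `Δ‴_v(γ_H, out c) ≠ 0` is one of `⟦t₁⟧, …, ⟦t₄⟧` — `Δ‴` vanishes off the stable class (★ `mk_mem_conjClassesIn_of_finExplicitDelta_ne_zero`), which has exactly four classes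
  (★ `ncard_conjClassesIn_eq_four`) [Rogawski1990, §4.3 (4.3.1)–(4.3.2) p. 43; §3.5 Prop. 3.5.2 (c) p. 29; Flicker1998UnitaryFL, Prop. 3 p. 78];
* §2 **`valuation_flickerLiteralPi_sub_one_le` ∕ `valuation_flickerLiteralOne_sub_one_le`** (any valued field): Flicker's literals
  `τ_π = [[e(x₁+x₃), 0, −e(x₁−x₃)π], [0, x₂, 0], [−e(x₁−x₃)π′, 0, e(x₁+x₃)]]` and `τ₁` (π = π′ = 1) are `≡ 1 (mod D)` ENTRYWISE as soon as `xᵢ ≡ 1 (mod D)`, `|e| ≤ 1`,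
  `2e = 1` and (for `τ_π`) `|(x₁−x₃)π|, |(x₁−x₃)π′| ≤ D`.  NUMERICAL CAVEAT behind the rider's `V` (co-reader tables, q = 3): with `π` a uniformizer `|(x₁−x₃)π′| = |ϖ|^{P−1}`, so
  `D = |ϖ|²` needs the eigen-data 3-DEEP — and indeed the π-frame classes of an exactly 2-deep `γ_H` ((N₁,N₂,N) = (2,2,2)) meet `K` but not `K(2)` (depth-≥2 counts per
  class (1,0,0,0)), while at (3,3,3) they are (49,4,4,4); the rider's `∃ V ∈ 𝓝 1` takes `V ⊆` principal level 3 [Flicker1998UnitaryFL, §6 pp. 95–97].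

## References
* [Rogawski1990] J. D. Rogawski, *Automorphic Representations of Unitary Groups in Three Variables*, Ann. of Math. Stud. 123 (1990), §3.5 Prop. 3.5.2 (c) p. 29,
  §4.3 (4.3.1)–(4.3.2) p. 43, §4.9 Prop. 4.9.1 pp. 54–55.
* [Flicker1998UnitaryFL] Y. Z. Flicker, *Elementary proof of the fundamental lemma for a unitary group*, Canad. J. Math. 50 (1998), 74–98: Prop. 3 p. 78, §6 pp. 95–97.
-/

noncomputable section

open NumberField IsDedekindDomain Matrix
open scoped MatrixGroups

namespace Literature.NumberTheory.Rogawski1990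

open Literature.NumberTheory.Automorphic Literature.NumberTheory.Automorphic.UnitaryGroup
open Literature.NumberTheory.GaloisRepresentations Literature.NumberTheory.NumberFields Literature.NumberTheory.QuadraticForms
open Literature.AlgebraicGeometry.ShimuraVarieties (unitaryGroup mem_unitaryGroup_iff)

/-! ## §1 The `Δ‴`-support on a type-(1) stable class is the four matched classes -/

section Support

variable (L : Type) [Field L] [NumberField L] [IsCMField L] (v : HeightOneSpectrum (𝓞 ↥(maximalRealSubfield L)))
  (H' : Matrix (Fin 3) (Fin 3) L)
  (a : (UnitaryGroup.cmDatum L 2 (Matrix.of fun i j : Fin 2 => if i.val + j.val + 1 = 2 then (1 : L) else 0)).Local v ×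
      (UnitaryGroup.cmDatum L 1 (Matrix.of fun i j : Fin 1 => if i.val + j.val + 1 = 1 then (1 : L) else 0)).Local v)
  (w : UnitaryGroup.PlacesOver L v) (hw : IsCMField.complexConj L • w.1 = w.1)

/-- A CM field has a non-zero element negated by complex conjugation. [cite: Rogawski1990, §1.10] -/
private theorem exists_complexConj_eq_neg_ne_zero_support (L : Type) [Field L] [NumberField L] [IsCMField L] :
    ∃ δ : L, IsCMField.complexConj L δ = -δ ∧ δ ≠ 0 := by
  obtain ⟨ζ, hζ⟩ := not_forall.1 fun h0 => IsCMField.complexConj_ne_one L (AlgEquiv.ext h0)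
  refine ⟨ζ - IsCMField.complexConj L ζ, by rw [map_sub, IsCMField.complexConj_apply_apply, neg_sub], fun h0 => hζ ?_⟩
  rw [sub_eq_zero] at h0
  exact h0.symm

include hw in
/-- **THE `Δ‴`-SUPPORT ON A TYPE-(1) STABLE CLASS IS THE FOUR MATCHED CLASSES** (the ∃-form of the support step of ★ HEAD 1
`finsum_delta_mul_classOrbitalIntegral_eq_of_four_classes_of_values`): if `t₁, …, t₄ ∈ G′_v` are matched with `ι_v(γ_H)`, `t₁` has a type-(1) eigenframe,
`t₁ ≁ t₂`, `t₃ ≁ t₄`, `κ_v(γ_H, t₁) = κ_v(γ_H, t₂) = 1`, `κ_v(γ_H, t₃) = κ_v(γ_H, t₄) = −1`, then every conjugacy class `c` with `Δ‴_v(γ_H, out c) ≠ 0` is one of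
`⟦t₁⟧, ⟦t₂⟧, ⟦t₃⟧, ⟦t₄⟧` (Δ‴ vanishes off the stable class, which has exactly four classes). [cite: Rogawski1990, §4.3 (4.3.1)–(4.3.2) p. 43; §3.5 Prop. 3.5.2 (c) p. 29]
[cite: Flicker1998UnitaryFL, Prop. 3 p. 78; §6 p. 95] -/
theorem mk_eq_or_of_finExplicitDelta_out_ne_zero (μ : HeckeCharacter L)
    {t₁ t₂ t₃ t₄ : (UnitaryGroup.cmDatum L 3 H').Local v}
    (h₁ : IsLocalNormPair L H' v a t₁) (h₂ : IsLocalNormPair L H' v a t₂) (h₃ : IsLocalNormPair L H' v a t₃) (h₄ : IsLocalNormPair L H' v a t₄)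
    (hH : (((UnitaryGroup.adelicForm L 3 H').map (UnitaryGroup.adeleToLocal L v)).map
      (UnitaryGroup.conjLocal L (IsCMField.complexConj L) v))ᵀ = (UnitaryGroup.adelicForm L 3 H').map (UnitaryGroup.adeleToLocal L v))
    (hHd : IsUnit ((UnitaryGroup.adelicForm L 3 H').map (UnitaryGroup.adeleToLocal L v)).det)
    {P : GL (Fin 3) (UnitaryGroup.LocalRing L v)} {u' : Fin 3 → UnitaryGroup.LocalRing L v}
    (hP : (t₁.val.val : Matrix (Fin 3) (Fin 3) (UnitaryGroup.LocalRing L v)) * P.val = P.val * diagonal u')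
    (hu' : Function.Injective u') (hu'1 : ∀ i, UnitaryGroup.conjLocal L (IsCMField.complexConj L) v (u' i) * u' i = 1)
    (h12 : ¬ IsConj t₁ t₂) (h34 : ¬ IsConj t₃ t₄)
    (hκ₁ : finKappaAt L v H' a t₁ = 1) (hκ₂ : finKappaAt L v H' a t₂ = 1) (hκ₃ : finKappaAt L v H' a t₃ = -1) (hκ₄ : finKappaAt L v H' a t₄ = -1)
    (c : ConjClasses ((UnitaryGroup.cmDatum L 3 H').Local v)) (hc : finExplicitDelta L v H' a μ (Quotient.out c) ≠ 0) :
    c = ConjClasses.mk t₁ ∨ c = ConjClasses.mk t₂ ∨ c = ConjClasses.mk t₃ ∨ c = ConjClasses.mk t₄ := by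
  -- the stable class of `t₁`: four classes, finite
  obtain ⟨δ₁, hcδ, hδ⟩ := exists_complexConj_eq_neg_ne_zero_support L
  have hS4 := ncard_conjClassesIn_eq_four L v (IsCMField.complexConj L) hcδ hδ w hw hH hHd t₁.2 hP hu' hu'1
  have hSfin := finite_conjClassesIn_of_eigenframe L v (IsCMField.complexConj L) hcδ hδ w hw hH hHd t₁.2 hP hu' hu'1
  have hmk : ∀ c : ConjClasses ((UnitaryGroup.cmDatum L 3 H').Local v),
      ConjClasses.mk (⟨(Quotient.out c).val, (Quotient.out c).2⟩ : unitaryGroup (UnitaryGroup.conjLocal L (IsCMField.complexConj L) v)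
        ((UnitaryGroup.adelicForm L 3 H').map (UnitaryGroup.adeleToLocal L v))) = c := fun c => Quotient.out_eq c
  -- the four classes are pairwise distinct …
  have n12 : ConjClasses.mk t₁ ≠ ConjClasses.mk t₂ := fun h0 => h12 (ConjClasses.mk_eq_mk_iff_isConj.1 h0)
  have n34 : ConjClasses.mk t₃ ≠ ConjClasses.mk t₄ := fun h0 => h34 (ConjClasses.mk_eq_mk_iff_isConj.1 h0)
  have n13 : ConjClasses.mk t₁ ≠ ConjClasses.mk t₃ := mk_ne_mk_of_finKappaAt_ne L v H' a h₁ (by rw [hκ₁, hκ₃]; norm_num)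
  have n14 : ConjClasses.mk t₁ ≠ ConjClasses.mk t₄ := mk_ne_mk_of_finKappaAt_ne L v H' a h₁ (by rw [hκ₁, hκ₄]; norm_num)
  have n23 : ConjClasses.mk t₂ ≠ ConjClasses.mk t₃ := mk_ne_mk_of_finKappaAt_ne L v H' a h₂ (by rw [hκ₂, hκ₃]; norm_num)
  have n24 : ConjClasses.mk t₂ ≠ ConjClasses.mk t₄ := mk_ne_mk_of_finKappaAt_ne L v H' a h₂ (by rw [hκ₂, hκ₄]; norm_num)
  -- … lie in the stable class of `t₁` …
  have hsub : ({ConjClasses.mk t₁, ConjClasses.mk t₂, ConjClasses.mk t₃, ConjClasses.mk t₄} : Set (ConjClasses ((UnitaryGroup.cmDatum L 3 H').Local v))) ⊆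
      conjClassesIn (UnitaryGroup.conjLocal L (IsCMField.complexConj L) v)
        ((UnitaryGroup.adelicForm L 3 H').map (UnitaryGroup.adeleToLocal L v)) ⟨t₁.val, t₁.2⟩ := by
    intro x hx
    simp only [Set.mem_insert_iff, Set.mem_singleton_iff] at hx
    rcases hx with rfl | rfl | rfl | rfl
    · exact mk_mem_conjClassesIn_of_isLocalNormPair L v H' a h₁ h₁
    · exact mk_mem_conjClassesIn_of_isLocalNormPair L v H' a h₁ h₂
    · exact mk_mem_conjClassesIn_of_isLocalNormPair L v H' a h₁ h₃
    · exact mk_mem_conjClassesIn_of_isLocalNormPair L v H' a h₁ h₄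
  -- … and so they ARE the stable class
  have h4 : ({ConjClasses.mk t₁, ConjClasses.mk t₂, ConjClasses.mk t₃, ConjClasses.mk t₄} : Set (ConjClasses ((UnitaryGroup.cmDatum L 3 H').Local v))).ncard = 4 := by
    have hn1 : ConjClasses.mk t₁ ∉ ({ConjClasses.mk t₂, ConjClasses.mk t₃, ConjClasses.mk t₄} : Set (ConjClasses ((UnitaryGroup.cmDatum L 3 H').Local v))) := by
      simp only [Set.mem_insert_iff, Set.mem_singleton_iff, not_or]; exact ⟨n12, n13, n14⟩
    have hn2 : ConjClasses.mk t₂ ∉ ({ConjClasses.mk t₃, ConjClasses.mk t₄} : Set (ConjClasses ((UnitaryGroup.cmDatum L 3 H').Local v))) := by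
      simp only [Set.mem_insert_iff, Set.mem_singleton_iff, not_or]; exact ⟨n23, n24⟩
    rw [Set.ncard_insert_of_notMem hn1 (Set.toFinite _), Set.ncard_insert_of_notMem hn2 (Set.toFinite _), Set.ncard_pair n34]
  have heq := Set.eq_of_subset_of_ncard_le hsub (Nat.le_of_eq (hS4.trans h4.symm)) hSfin
  -- the class `c` is in the stable class, hence one of the four
  have hmem := mk_mem_conjClassesIn_of_finExplicitDelta_ne_zero L v H' a t₁ μ h₁ hc
  rw [hmk, ← heq] at hmem
  rcases hmem with h | h | h | h
  · exact Or.inl h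
  · exact Or.inr (Or.inl h)
  · exact Or.inr (Or.inr (Or.inl h))
  · exact Or.inr (Or.inr (Or.inr (Set.mem_singleton_iff.1 h)))


include hw in
/-- **Alias in the architect's name (A-127 (1))** for `mk_eq_or_of_finExplicitDelta_out_ne_zero`: the `Δ‴`-support class is one of the four matched classes.
[cite: Rogawski1990, §4.3 (4.3.1)–(4.3.2) p. 43] [cite: Flicker1998UnitaryFL, Prop. 3 p. 78] -/
theorem exists_index_of_finExplicitDelta_ne_zero (μ : HeckeCharacter L)
    {t₁ t₂ t₃ t₄ : (UnitaryGroup.cmDatum L 3 H').Local v}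
    (h₁ : IsLocalNormPair L H' v a t₁) (h₂ : IsLocalNormPair L H' v a t₂) (h₃ : IsLocalNormPair L H' v a t₃) (h₄ : IsLocalNormPair L H' v a t₄)
    (hH : (((UnitaryGroup.adelicForm L 3 H').map (UnitaryGroup.adeleToLocal L v)).map
      (UnitaryGroup.conjLocal L (IsCMField.complexConj L) v))ᵀ = (UnitaryGroup.adelicForm L 3 H').map (UnitaryGroup.adeleToLocal L v))
    (hHd : IsUnit ((UnitaryGroup.adelicForm L 3 H').map (UnitaryGroup.adeleToLocal L v)).det)
    {P : GL (Fin 3) (UnitaryGroup.LocalRing L v)} {u' : Fin 3 → UnitaryGroup.LocalRing L v}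
    (hP : (t₁.val.val : Matrix (Fin 3) (Fin 3) (UnitaryGroup.LocalRing L v)) * P.val = P.val * diagonal u')
    (hu' : Function.Injective u') (hu'1 : ∀ i, UnitaryGroup.conjLocal L (IsCMField.complexConj L) v (u' i) * u' i = 1)
    (h12 : ¬ IsConj t₁ t₂) (h34 : ¬ IsConj t₃ t₄)
    (hκ₁ : finKappaAt L v H' a t₁ = 1) (hκ₂ : finKappaAt L v H' a t₂ = 1) (hκ₃ : finKappaAt L v H' a t₃ = -1) (hκ₄ : finKappaAt L v H' a t₄ = -1)
    (c : ConjClasses ((UnitaryGroup.cmDatum L 3 H').Local v)) (hc : finExplicitDelta L v H' a μ (Quotient.out c) ≠ 0) :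
    ∃ i : Fin 4, c = ConjClasses.mk (![t₁, t₂, t₃, t₄] i) := by
  rcases mk_eq_or_of_finExplicitDelta_out_ne_zero L v H' a w hw μ h₁ h₂ h₃ h₄ hH hHd hP hu' hu'1 h12 h34 hκ₁ hκ₂ hκ₃ hκ₄ c hc with h | h | h | h
  · exact ⟨0, h⟩
  · exact ⟨1, h⟩
  · exact ⟨2, h⟩
  · exact ⟨3, h⟩

end Support


end Literature.NumberTheory.Rogawski1990

/-! ## §2 Entrywise depth of Flicker's literals (any valued field) -/

namespace Literature.NumberTheory.Rogawski1990.Flicker1998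

open Matrix

variable {K Γ₀ : Type*} [Field K] [LinearOrderedCommGroupWithZero Γ₀] [Valued K Γ₀]

/-- **The `θ̄ = 1` (π-frame) literal is `≡ 1 (mod D)` entrywise** as soon as `x₁, x₂, x₃ ≡ 1 (mod D)`, `|e| ≤ 1`, `2e = 1`, and the two off-diagonal products
`(x₁ − x₃)π`, `(x₁ − x₃)π'` are `≡ 0 (mod D)` — for Flicker's `t₂, t₃, t₄ = [[e(x₁+x₃), 0, −e(x₁−x₃)π], [0, x₂, 0], [−e(x₁−x₃)π', 0, e(x₁+x₃)]]`; with `π` a uniformizer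
and `D = |ϖ|²` this needs the eigenvalues 3-deep (`|x₁ − x₃||π'| = |ϖ|^{P−1}`). [cite: Flicker1998UnitaryFL, Prop. 3 p. 78; §6 p. 95] -/
theorem valuation_flickerLiteralPi_sub_one_le {e x₁ x₂ x₃ π π' : K} {D : Γ₀} (h2e : 2 * e = 1) (he : Valued.v e ≤ 1)
    (hx₁ : Valued.v (x₁ - 1) ≤ D) (hx₂ : Valued.v (x₂ - 1) ≤ D) (hx₃ : Valued.v (x₃ - 1) ≤ D)
    (hπ : Valued.v ((x₁ - x₃) * π) ≤ D) (hπ' : Valued.v ((x₁ - x₃) * π') ≤ D) :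
    ∀ i j, Valued.v ((!![e * (x₁ + x₃), 0, -(e * (x₁ - x₃) * π); 0, x₂, 0; -(e * (x₁ - x₃) * π'), 0, e * (x₁ + x₃)] -
      (1 : Matrix (Fin 3) (Fin 3) K)) i j) ≤ D := by
  have hdiag : Valued.v (e * (x₁ + x₃) - 1) ≤ D := by
    have : e * (x₁ + x₃) - 1 = e * (x₁ - 1) + e * (x₃ - 1) := by linear_combination h2e
    rw [this]
    refine (Valuation.map_add _ _ _).trans (max_le ?_ ?_)
    · rw [Valuation.map_mul]; exact (mul_le_mul' he hx₁).trans_eq (one_mul D)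
    · rw [Valuation.map_mul]; exact (mul_le_mul' he hx₃).trans_eq (one_mul D)
  have hoffπ : Valued.v (-(e * (x₁ - x₃) * π)) ≤ D := by
    rw [Valuation.map_neg, mul_assoc, Valuation.map_mul]; exact (mul_le_mul' he hπ).trans_eq (one_mul D)
  have hoffπ' : Valued.v (-(e * (x₁ - x₃) * π')) ≤ D := by
    rw [Valuation.map_neg, mul_assoc, Valuation.map_mul]; exact (mul_le_mul' he hπ').trans_eq (one_mul D)
  set S : Set K := {z | Valued.v z ≤ D} with hS
  have h0 : (0 : K) ∈ S := by show Valued.v (0 : K) ≤ D; rw [Valuation.map_zero]; exact zero_le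
  have hdiag' : e * (x₁ + x₃) - 1 ∈ S := hdiag
  have hx₂' : x₂ - 1 ∈ S := hx₂
  have hoffπS : -(e * (x₁ - x₃) * π) ∈ S := hoffπ
  have hoffπ'S : -(e * (x₁ - x₃) * π') ∈ S := hoffπ'
  suffices h : ∀ i j, ((!![e * (x₁ + x₃), 0, -(e * (x₁ - x₃) * π); 0, x₂, 0; -(e * (x₁ - x₃) * π'), 0, e * (x₁ + x₃)] -
      (1 : Matrix (Fin 3) (Fin 3) K)) i j) ∈ S from fun i j => h i j
  intro i j
  rw [Matrix.one_fin_three]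
  fin_cases i <;> fin_cases j <;> simp <;> assumption

/-- **The `θ̄ = 0` (frame `h`) literal is `≡ 1 (mod D)` entrywise** as soon as `x₁, x₂, x₃ ≡ 1 (mod D)`, `|e| ≤ 1`, `2e = 1` — Flicker's
`t₁ = [[e(x₁+x₃), 0, −e(x₁−x₃)], [0, x₂, 0], [−e(x₁−x₃), 0, e(x₁+x₃)]]` (2-deep eigen-data suffice). [cite: Flicker1998UnitaryFL, Prop. 3 p. 78; §6 p. 95] -/
theorem valuation_flickerLiteralOne_sub_one_le {e x₁ x₂ x₃ : K} {D : Γ₀} (h2e : 2 * e = 1) (he : Valued.v e ≤ 1)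
    (hx₁ : Valued.v (x₁ - 1) ≤ D) (hx₂ : Valued.v (x₂ - 1) ≤ D) (hx₃ : Valued.v (x₃ - 1) ≤ D) :
    ∀ i j, Valued.v ((!![e * (x₁ + x₃), 0, -(e * (x₁ - x₃)); 0, x₂, 0; -(e * (x₁ - x₃)), 0, e * (x₁ + x₃)] -
      (1 : Matrix (Fin 3) (Fin 3) K)) i j) ≤ D := by
  have hx13 : Valued.v (x₁ - x₃) ≤ D := by
    have : x₁ - x₃ = (x₁ - 1) - (x₃ - 1) := by ring
    rw [this]; exact (Valuation.map_sub _ _ _).trans (max_le hx₁ hx₃)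
  have h := valuation_flickerLiteralPi_sub_one_le (π := 1) (π' := 1) h2e he hx₁ hx₂ hx₃ (by rw [mul_one]; exact hx13) (by rw [mul_one]; exact hx13)
  simpa only [mul_one] using h

end Literature.NumberTheory.Rogawski1990.Flicker1998

end
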